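import Summits.CriticalPhenomena.CardyFormulaZ2.Theorems.CardyIKTransportIKLinearTransportLine
import Summits.CriticalPhenomena.CardyFormulaZ2.Theorems.IKLinearTransport.Negative.CruxConsequences
import Summits.CriticalPhenomena.CardyFormulaZ2.Theorems.IKLinearTransport.Negative.LoadBearing
import Literature.Probability.LatticeModels.CornerFugacityMeasure
import Literature.Probability.Percolation.QuadCrossingSquareModel

/-!
# Line `spectral-shear` — crux `CardyIKTransport.IKLinearTransport` (stmt-CriticalPhenomena-5076)
# SKELETON (crux-plan, 2026-08-16): seven registered stubs `stub_*`, composition sorry-free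

IDEA (crux idea card `Cruxes/IKLinearTransport/Ideas/spectral-shear.md`, triage r1-2 / r1-3: pass).
On the cylinder `ℤ/N` the row transfer operators `T_N(u)`, `u ∈ [π/3, 2π/3]`, of the `n = 1` dilute
`A₂⁽²⁾` (Izergin–Korepin) family commute with each other and with the rotation, and arc insertions /
read-outs are `u`-FREE; so all `u`-dependence of every macroscopic arc-connectivity correlation sits
in the eigenvalue functions `u ↦ Λ_j(u)` on COMMON (generalised) eigenvectors, and the `λ = π/3`
cubic closure / `T–Q` system (arXiv:2211.12379 §5.1, §6, Conj. 1) predicts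
`log Λ_j(u)/Λ_0(u) = -(2π/N)(x_j sin u + i s_j cos u) + o(1/N)`: `M` rows of `IK(u)` act on
everything macroscopic like `M sin u` rows of `IK(π/2)` followed by a slide of `M cos u` columns —
universality INSIDE the family up to the EXPLICIT real-linear map `1 ↦ 1, i ↦ e^{iu}` (this file's
mirror convention: the coin bias `b(u)` sits on the ANTI-diagonal, so the `u = π/3` member is the
crux's `S = ∅` model = site-`𝕋`, equilateral under `K₀ = moduliShear ζ`, `ζ = e^{iπ/3}`; triage
sharpening "mirror" honoured). No coupling, no transport of configurations.

THE CHAIN. `stub_RowExchange` (exact: the law of slab-restricted arc-connectivity patterns on a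
finite inhomogeneous cylinder is invariant under transposing two adjacent row parameters — the
law-level form of the diagram-resolved Yang–Baxter commutation, verified by enumeration for `L ≤ 6`
in five encodings) ⟶ `stub_SpectralShearCylinder` (XL, hardest: the spectral law for all low-lying
levels + tightness ⇒ `CylinderShearAt u` for every `u ∈ [π/3, π/2]`, calibrated by the first
milestone `stub_CylinderArmAnisotropy`: the one-arm gap scales like `sin u`) ⟶ at `u = π/3`,
`stub_SlabToRectangles` (cylinder ⟶ plane by gauge screening; slab chains ⟶ joint laws of crude
crossings of axis-parallel RECTANGLES for `IK(π/2)` versus the `K₀⁻¹`-images for the `S = ∅`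
member; a-priori input `stub_IsoApriori` = conditional RSW for the two homogeneous members) ⟶
`stub_RectanglesDetermine` (joint rectangle statistics + RSW-type a-priori bounds determine the
quad-crossing scaling limit; with crude Cardy for the `S = ∅` member along `K₀` —
`stub_CrudeCardyTri`, SHARED verbatim with line `pinned-diagram-exchange` — this is Cardy's formula
for `IK(π/2)` itself, `K = 1`) ⟶ `crux_iff` with `K := 1`.

DISPROOF USED (`Cruxes/IKLinearTransport/Disproof.lean`, cycle 1; landed `Negative/CruxConsequences`,
`Negative/LoadBearing`, imported here): `crux_iff_cardyOnImages` is the shape the composition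
produces (`K = 1`); `iKLinearTransport_false_without_axisBits` / `_false_without_slack` constrain the
MODEL and are honoured because every planar statement below is over the verbatim gauge
(`μIK`, `obs`, `blackEdges`, `embDomainCrossing sqEmb` of the vocabulary file) — the axis bits are
what makes the planar window law equal to the cylinder window law up to parity conditioning
(used in `stub_SlabToRectangles`), the `2δ` slack is kept; `crux_forces_limits_mem_Ioo` is met by
`stub_IsoApriori`; Disproof §4.6 / triage r1-1 item 2 (diagram identities are FALSE on open strips):
`stub_RowExchange` is stated on CYLINDERS only; triage r1-2 item 1 (exact zero modes of the colour
sector at `u = π/3`, massive): `CylinderShearAt` only speaks about macroscopic limits, never about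
finite-`N` spectral identities. Negatives index (8 entries): no stub is an instance.
-/

noncomputable section

namespace Summit.CriticalPhenomena.CardyFormulaZ2.Cruxes.IKLinearTransport.SpectralShear

open scoped BigOperators Topology Classical MeasureTheory ProbabilityTheory ENNReal
open Filter Set Function MeasureTheory
open Literature.Probability.Percolation Literature.Probability.LatticeModels
open Literature.Probability.RandomPlanarGeometry
open Summit.CriticalPhenomena.CardyFormulaZ2.Theorems.IKLinearTransport
open Summit.CriticalPhenomena.CardyFormulaZ2.Theorems.IKLinearTransport.PinnedDiagramExchange

/-! ## §1 Finite Izergin–Korepin cylinders with row-dependent spectral parameter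

Cells `ZMod N × Fin (M+1)` (circumference `N`, cell rows `0 … M`, free rims), faces
`ZMod N × Fin M` (face `(x, j)` has corners `(x, j), (x+1, j), (x, j+1), (x+1, j+1)`), one coin per
face (`true` = ANTI-diagonal `(x, j+1) — (x+1, j)`), face row `j` carries the parameter `us j`.
Gibbs weight of a configuration = `∏_faces t(us j)^{[odd face]} · (b(us j) | 1 - b(us j))`
(anti | main), `t = ikCornerFugacity`, `b = ikCoinBias` of the tree (arXiv:2211.12379 §3.1, §3.6:
at `u = π/3`, `t = 1` and `b = 1` — all diagonals anti, i.i.d. fair colours: site percolation on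
`𝕋`, the crux's `S = ∅` member; at `u = π/2`, `(t, b) = (√3/2, ½)`: the crux's `P_IK` up to the
planar gauge). -/

/-- Configurations of the cylinder `ℤ/N × [0, M]`: (cell colouring, anti-diagonal flags). [folklore] -/
abbrev Cfg (N M : ℕ) : Type := (ZMod N × Fin (M + 1) → Bool) × (ZMod N × Fin M → Bool)

/-- The random triangulation of the cylinder read from the flags `a`. [folklore] -/
def cylGraph (N M : ℕ) (a : ZMod N × Fin M → Bool) : SimpleGraph (ZMod N × Fin (M + 1)) :=
  SimpleGraph.fromRel fun p q =>
    (q.1 = p.1 + 1 ∧ q.2 = p.2) ∨ (q.1 = p.1 ∧ q.2.val = p.2.val + 1) ∨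
    (∃ j : Fin M, p.2 = j.castSucc ∧ q.2 = j.succ ∧ q.1 = p.1 + 1 ∧ a (p.1, j) = false) ∨
    (∃ j : Fin M, p.2 = j.succ ∧ q.2 = j.castSucc ∧ q.1 = p.1 + 1 ∧ a (p.1, j) = true)

/-- Parity of a face (odd number of black corners). [folklore] -/
def faceOdd {N M : ℕ} (col : ZMod N × Fin (M + 1) → Bool) (f : ZMod N × Fin M) : Bool :=
  (col (f.1, f.2.castSucc) ^^ col (f.1 + 1, f.2.castSucc)) ^^ (col (f.1, f.2.succ) ^^ col (f.1 + 1, f.2.succ))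

/-- Local face weight of the `IK(u)` row: corner fugacity on odd faces, coin bias on the
anti-diagonal (mirror of the tree's NE–SW convention). [folklore] -/
def faceWeight (u : ℝ) (odd anti : Bool) : ℝ :=
  (if odd then ((ikCornerFugacity u : NNReal) : ℝ) else 1) *
    (if anti then ((ikCoinBias u : unitInterval) : ℝ) else 1 - ((ikCoinBias u : unitInterval) : ℝ))

/-- Gibbs weight of a cylinder configuration with row parameters `us` (face row `j ↦ us j`). [folklore] -/
def cylWeight (N M : ℕ) [NeZero N] (us : ℕ → ℝ) (c : Cfg N M) : ℝ :=
  ∏ f : ZMod N × Fin M, faceWeight (us f.2.val) (faceOdd c.1 f) (c.2 f)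

/-- Probability of an event of configurations under the free-rim inhomogeneous IK cylinder. [folklore] -/
def cylProb (N M : ℕ) [NeZero N] (us : ℕ → ℝ) (E : Set (Cfg N M)) : ℝ :=
  (∑ c : Cfg N M, if c ∈ E then cylWeight N M us c else 0) / (∑ c : Cfg N M, cylWeight N M us c)

/-- `p` and `q` are joined by a path of cells of colour `c` inside the slab of cell rows `[lo, hi]`. [folklore] -/
def SlabConn {N M : ℕ} (cfg : Cfg N M) (c : Bool) (lo hi : ℕ) (p q : ZMod N × Fin (M + 1)) : Prop :=
  ∃ (hp : cfg.1 p = c ∧ lo ≤ p.2.val ∧ p.2.val ≤ hi) (hq : cfg.1 q = c ∧ lo ≤ q.2.val ∧ q.2.val ≤ hi),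
    ((cylGraph N M cfg.2).induce {r | cfg.1 r = c ∧ lo ≤ r.2.val ∧ r.2.val ≤ hi}).Reachable ⟨p, hp⟩ ⟨q, hq⟩

/-- The horizontal arc of `ℓ` consecutive cells starting at column `s` on cell row `r`. [folklore] -/
def arcCells (N M : ℕ) (r : ℕ) (s : ℤ) (ℓ : ℕ) : Set (ZMod N × Fin (M + 1)) :=
  {p | p.2.val = r ∧ ∃ i : ℕ, i < ℓ ∧ p.1 = ((s + i : ℤ) : ZMod N)}

/-- Bottom-rim-to-top-rim black connection probability of the homogeneous `IK(u)` cylinder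
`ℤ/N × [0, M]` (free rims). [folklore] -/
def rimToRimProb (N M : ℕ) (u : ℝ) : ℝ :=
  if h : N = 0 then 0 else
    haveI : NeZero N := ⟨h⟩
    cylProb N M (fun _ => u) {cfg | ∃ p q : ZMod N × Fin (M + 1), p.2.val = 0 ∧ q.2.val = M ∧
      SlabConn cfg true 0 M p q}

/-! ## §2 Slab-restricted arc-connectivity patterns: lattice data, macroscopic data, the shear -/

/-- Lattice data of a pattern observable: circumference, height, `m` distinguished cell rows,
`k` arcs (start column, length); which arc lies on which row is the fixed map `rowOf`. [folklore] -/
structure SlabData (m k : ℕ) where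
  /-- circumference `N` -/
  circ : ℕ
  /-- height `M` (cell rows `0 … M`) -/
  height : ℕ
  /-- the distinguished cell rows -/
  row : Fin m → ℕ
  /-- start column of each arc -/
  start : Fin k → ℤ
  /-- length of each arc -/
  len : Fin k → ℕ

/-- Admissible lattice data: `N ≥ 3`, rows inside the cylinder, arc lengths in `[1, N]`. [folklore] -/
def SlabData.Admissible {m k : ℕ} (D : SlabData m k) : Prop :=
  3 ≤ D.circ ∧ (∀ p, D.row p ≤ D.height) ∧ ∀ i, 1 ≤ D.len i ∧ D.len i ≤ D.circ

/-- A query: are arcs `src` and `tgt` joined by a path of colour `colour` inside the slab between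
the distinguished rows `lo` and `hi`? [folklore] -/
structure Query (m k : ℕ) where
  src : Fin k
  tgt : Fin k
  lo : Fin m
  hi : Fin m
  colour : Bool

/-- The query holds in the configuration `cfg` of the cylinder of `D`. [folklore] -/
def QueryHolds {m k : ℕ} (D : SlabData m k) (rowOf : Fin k → Fin m) (cfg : Cfg D.circ D.height)
    (Q : Query m k) : Prop :=
  ∃ p ∈ arcCells D.circ D.height (D.row (rowOf Q.src)) (D.start Q.src) (D.len Q.src),
    ∃ q ∈ arcCells D.circ D.height (D.row (rowOf Q.tgt)) (D.start Q.tgt) (D.len Q.tgt),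
      SlabConn cfg Q.colour (D.row Q.lo) (D.row Q.hi) p q

/-- Probability that the vector of answers to the queries `qs` equals `v`, under the cylinder of
`D` with row parameters `us`. [folklore] -/
def cylPatternProb {m k nq : ℕ} (us : ℕ → ℝ) (D : SlabData m k) (rowOf : Fin k → Fin m)
    (qs : Fin nq → Query m k) (v : Fin nq → Bool) : ℝ :=
  if h : D.circ = 0 then 0 else
    haveI : NeZero D.circ := ⟨h⟩
    cylProb D.circ D.height us {cfg | ∀ t, QueryHolds D rowOf cfg (qs t) ↔ v t = true}

/-- Macroscopic data: aspect `τ = M/N`, heights `θ_p = row_p/N`, starts `α_i = start_i/N`,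
lengths `ℓ_i = len_i/N`. [folklore] -/
structure MacroData (m k : ℕ) where
  τ : ℝ
  θ : Fin m → ℝ
  α : Fin k → ℝ
  ℓ : Fin k → ℝ

/-- Admissible macroscopic data: positive aspect, strictly increasing heights in `[0, τ]`, arc
lengths in `(0, 1]` (`1` = a full ring). [folklore] -/
def MacroData.Admissible {m k : ℕ} (d : MacroData m k) : Prop :=
  0 < d.τ ∧ StrictMono d.θ ∧ (∀ p, 0 ≤ d.θ p ∧ d.θ p ≤ d.τ) ∧ ∀ i, 0 < d.ℓ i ∧ d.ℓ i ≤ 1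

/-- THE EXPLICIT SHEAR. `IK(u)` drawn Z-invariantly puts cell `(x, y)` at `x + y e^{iu}`; reading the
same drawn picture with the square grid of `IK(π/2)`: heights `× sin u`, columns slide by
`height × cos u`. [folklore] -/
def MacroData.shear {m k : ℕ} (d : MacroData m k) (rowOf : Fin k → Fin m) (u : ℝ) : MacroData m k where
  τ := d.τ * Real.sin u
  θ := fun p => d.θ p * Real.sin u
  α := fun i => d.α i + d.θ (rowOf i) * Real.cos u
  ℓ := d.ℓ

/-- A sequence of lattice data converges to the macroscopic data `d` (circumference `→ ∞`, all
ratios converge). [folklore] -/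
def ConvergesTo {m k : ℕ} (D : ℕ → SlabData m k) (d : MacroData m k) : Prop :=
  Tendsto (fun n => (D n).circ) atTop atTop ∧
  Tendsto (fun n => ((D n).height : ℝ) / (D n).circ) atTop (𝓝 d.τ) ∧
  (∀ p, Tendsto (fun n => ((D n).row p : ℝ) / (D n).circ) atTop (𝓝 (d.θ p))) ∧
  (∀ i, Tendsto (fun n => ((D n).start i : ℝ) / (D n).circ) atTop (𝓝 (d.α i))) ∧
  (∀ i, Tendsto (fun n => ((D n).len i : ℝ) / (D n).circ) atTop (𝓝 (d.ℓ i)))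

/-! ## §3 Stub statements 1–3: exact row exchange, one-arm anisotropy, the cylinder shear

Statement-level vocabulary is PARAMETRISED (no closed `def … : Prop`, so that this part of the file
can be proposed verbatim as a `Theorems/` vocabulary file, as the lead of line pinned-diagram-exchange
had to do for its v2); the registered stub SIGNATURES below quantify the predicates explicitly. -/

/-- The observable (rows of the arcs, slabs of the queries) does not look at cell row `j₀ + 1`
except through connections passing THROUGH the three-row block `j₀, j₀+1, j₀+2`: arcs lie off cell
row `j₀ + 1`, and every query slab lies below the block, above it, or contains all of it. [folklore] -/
def ExchangeCompatible {m k nq : ℕ} (D : SlabData m k) (rowOf : Fin k → Fin m)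
    (qs : Fin nq → Query m k) (j₀ : ℕ) : Prop :=
  j₀ + 2 ≤ D.height ∧ (∀ i, D.row (rowOf i) ≠ j₀ + 1) ∧
    ∀ t, D.row (qs t).hi ≤ j₀ ∨ j₀ + 2 ≤ D.row (qs t).lo ∨ (D.row (qs t).lo ≤ j₀ ∧ j₀ + 2 ≤ D.row (qs t).hi)

/-- ROW EXCHANGE at `(D, rowOf, qs, us, j₀)` (registered stub `stub_RowExchange : ∀ …, D.Admissible →
(∀ j, us j ∈ [π/3, 2π/3]) → ExchangeCompatible D rowOf qs j₀ → ∀ v, RowExchangeAt D rowOf qs us j₀ v`).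
Transposing the parameters of the adjacent face rows `j₀`, `j₀ + 1` does not change the probability
of the slab-restricted arc-connectivity pattern `v`. This is the LAW-LEVEL form of the
diagram-resolved Yang–Baxter commutation `T(u)T(u') = T(u')T(u)` of the dilute `A₂⁽²⁾` row transfer
matrices (arXiv:2211.12379 §3.5; `CurveDiagramExchange` of the sibling card abel-flux-ward, 0
mismatches at `L ≤ 5` for generic pairs in three encodings; `DiagramExchangeAt` of line
pinned-diagram-exchange is the pair `(π/3, π/2)`), and it is what makes the marked transfer operators
a commuting family with `u`-free insertions. Cylinders only (false on open strips: triage r1-1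
item 2, Disproof §4.6). [folklore] -/
def RowExchangeAt {m k nq : ℕ} (D : SlabData m k) (rowOf : Fin k → Fin m) (qs : Fin nq → Query m k)
    (us : ℕ → ℝ) (j₀ : ℕ) (v : Fin nq → Bool) : Prop :=
  cylPatternProb us D rowOf qs v = cylPatternProb (us ∘ Equiv.swap j₀ (j₀ + 1)) D rowOf qs v

/-- ONE-ARM RATE CALIBRATION with constant `x` at parameter `u` (registered stub
`stub_CylinderArmAnisotropy : ∃ x, 0 < x ∧ ∀ u ∈ [π/3, π/2], ArmRateAt x u`; the card's First lemma,
the line's first milestone and cheapest falsifier). The rim-to-rim (one-arm) decay rate `r_N(u)` of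
the homogeneous `IK(u)` cylinder of circumference `N` exists for every `N ≥ 3` and
`N · r_N(u) → x · sin u` (conformally `x = 2π · 5/48`; the value is not asserted, the
`u`-INDEPENDENCE of `x` is the content). Spectrally `r_N(u) = log Λ_0(u)/Λ_arm(u)`: the `1/N` term
of ONE eigenvalue ratio — eq. (4.3) of arXiv:2211.12379 for one pair of ground states, whose
analytic derivation (their §6; rigorous template: the six-vertex Perron asymptotics imported by
arXiv:2012.11672 Thm 2.7) is the model of proof; it calibrates the common velocity `sin u` used
by `stub_SpectralShearCylinder`. [folklore] -/
def ArmRateAt (x u : ℝ) : Prop :=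
  ∃ r : ℕ → ℝ,
    (∀ N : ℕ, 3 ≤ N →
      Tendsto (fun M : ℕ => -Real.log (rimToRimProb N M u) / (M : ℝ)) atTop (𝓝 (r N))) ∧
    Tendsto (fun N : ℕ => (N : ℝ) * r N) atTop (𝓝 (x * Real.sin u))

/-- SPECTRAL SHEAR ON THE CYLINDER at parameter `u` (registered stub `stub_SpectralShearCylinder :
(row exchange) → (∃ x, 0 < x ∧ ∀ u ∈ [π/3, π/2], ArmRateAt x u) → ∀ u ∈ [π/3, π/2], CylinderShearAt u`).
For every admissible pattern observable (finitely many arcs of macroscopic length on finitely many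
distinguished rows at strictly increasing macroscopic heights, finitely many colour-`c` connection
queries restricted to slabs of positive macroscopic height between distinguished rows) and every
two sequences of lattice data on common circumferences `N → ∞` converging to the macroscopic data
`d` resp. to its shear `d.shear rowOf u` (heights `× sin u`, start columns slid by
`height × cos u`), the pattern probabilities under homogeneous `IK(u)` and under `IK(π/2)` differ by
`o(1)`. Intended proof: common eigenvectors (row exchange), `u`-free arc insertions and read-outs,
the spectral law `N log Λ_j(u)/Λ_0(u) → -2π(x_j sin u + i s_j cos u)` for every level below any
fixed `X` on joint generalised eigenspaces (`sℓ(3)` cubic closure / `T–Q` at `λ = π/3`,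
arXiv:2211.12379 §5.1, §6, Conj. 1; `s_j` = exact lattice momentum), tightness of the spectral
sums at macroscopic separations. Only macroscopic limits are asserted (finite-`N` dispersion is
not linear; the colour sector's exact zero modes at `u = π/3` are massive, triage r1-2 item 1). [folklore] -/
def CylinderShearAt (u : ℝ) : Prop :=
  ∀ (m k nq : ℕ) (rowOf : Fin k → Fin m) (qs : Fin nq → Query m k) (d : MacroData m k),
    (∀ t, (qs t).lo < (qs t).hi) → d.Admissible →
    ∀ D E : ℕ → SlabData m k, (∀ n, (D n).Admissible) → (∀ n, (E n).Admissible) →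
      (∀ n, (E n).circ = (D n).circ) → ConvergesTo D d → ConvergesTo E (d.shear rowOf u) →
      ∀ v : Fin nq → Bool,
        Tendsto (fun n => cylPatternProb (fun _ => u) (D n) rowOf qs v -
          cylPatternProb (fun _ => Real.pi / 2) (E n) rowOf qs v) atTop (𝓝 0)

/-! ## §4 Stub statements 4–6: a-priori bounds, slab chains ⇒ rectangles, rectangles determine -/

/-- Joint probability, under the `S`-mixed planar gauge at mesh `δ`, that the crude crossing
indicators (arc `a i` to arc `a i + 2`) of the conformal rectangles `Q i` form the vector `v`
(`μIK`, `obs`, `blackEdges`, `sqEmb` of the vocabulary file; `S = univ` is the crux's `P_IK`, `S = ∅`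
the site-`𝕋` member). [folklore] -/
def jointCrossProb {r : ℕ} (S : Set ℤ) (Q : Fin r → ConformalRectangle) (a : Fin r → Fin 4)
    (δ : ℝ) (v : Fin r → Bool) : ℝ :=
  μIK.real {ω | ∀ i, (blackEdges (obs S ω) ∈
    embDomainCrossing sqEmb (Q i).carrier δ ((Q i).arc (a i)) ((Q i).arc (a i + 2))) ↔ v i = true}

/-- RECTANGLE TRANSPORT through `K₁` (conclusion of `stub_SlabToRectangles` with `K₁ = K₀⁻¹`,
`K₀ = moduliShear ζ`): for every finite family of axis-parallel rectangles (`rectQuad`: arc `0` =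
bottom, `1` = right, `2` = top, `3` = left) and crossing directions, the joint law of the crude
crossing indicators under `IK(π/2)` (`S = univ`) and the joint law for the `K₁`-images under the
`S = ∅` member have the same `δ → 0⁺` asymptotics (difference `→ 0`; no limit is asserted).
A-priori input: conditional RSW for the two homogeneous members (`stub_IsoApriori`). [folklore] -/
def RectTransport (K₁ : ℂ ≃L[ℝ] ℂ) : Prop :=
  ∀ (r : ℕ) (x₀ x₁ y₀ y₁ : Fin r → ℝ) (hx : ∀ i, x₀ i < x₁ i) (hy : ∀ i, y₀ i < y₁ i)
    (a : Fin r → Fin 4) (v : Fin r → Bool),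
    Tendsto (fun δ : ℝ =>
      jointCrossProb Set.univ (fun i => rectQuad (x₀ i) (x₁ i) (y₀ i) (y₁ i) (hx i) (hy i)) a δ v -
      jointCrossProb ∅ (fun i => (rectQuad (x₀ i) (x₁ i) (y₀ i) (y₁ i) (hx i) (hy i)).map
        K₁.toHomeomorph) a δ v) (𝓝[>] 0) (𝓝 0)

/-! ## §5 The composition (kernel-checked, no `sorry`) -/

/-- Local alias of the crux decl, used only as the conclusion of the sorry-free composition, so that
`IKLinearTransport_of` is the only theorem of this file concluding the crux BY NAME. [folklore] -/
abbrev CruxStatement : Prop :=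
  Summit.CriticalPhenomena.CardyFormulaZ2.Theses.CardyIKTransport.IKLinearTransport

/-- `π/3 ∈ [π/3, π/2]`. [folklore] -/
theorem pi_div_three_mem : Real.pi / 3 ∈ Icc (Real.pi / 3) (Real.pi / 2) :=
  ⟨le_rfl, by have := Real.pi_pos; nlinarith⟩

/-- Cardy in every `R` is Cardy on the images under the identity map (the crux's shape at `K = 1`). [folklore] -/
theorem cardyOnImages_refl_of_isoCardy
    (h : ∀ R : ConformalRectangle, R.HasCrossingLimit (mixedCrossingProb Set.univ R)
      Literature.Probability.RandomPlanarGeometry.cardyFunction) :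
    Negative.CardyOnImages (mixedCrossingProb Set.univ) (ContinuousLinearEquiv.refl ℝ ℂ) := by
  intro R
  have e : (ContinuousLinearEquiv.refl ℝ ℂ).toHomeomorph = Homeomorph.mulLeft₀ (1 : ℂ) one_ne_zero :=
    Homeomorph.ext fun z => by simp
  rw [e, Negative.hasCrossingLimit_map_mulLeft_iff]
  exact h R

/-- THE COMPOSITION (kernel-checked, no `sorry`): the seven registered stub signatures of the line
`spectral-shear` imply the crux, with the EXPLICIT linear map `K = 1`. Row exchange and the one-arm
calibration feed the spectral shear, used at `u = π/3` (site-`𝕋`); `SlabToRectangles` turns the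
cylinder shear into rectangle transport through `K₀⁻¹`; `RectanglesDetermine` + crude Cardy for the
`S = ∅` member along `K₀` give Cardy for `IK(π/2)` in every conformal rectangle; `crux_iff`
(Smirnov's theorem inside, proved in the tree) concludes. [folklore] -/
theorem IKLinearTransport_of_stubs
    (h₁ : ∀ (m k nq : ℕ) (D : SlabData m k) (rowOf : Fin k → Fin m) (qs : Fin nq → Query m k)
      (us : ℕ → ℝ) (j₀ : ℕ), D.Admissible → (∀ j, us j ∈ Icc (Real.pi / 3) (2 * Real.pi / 3)) →
      ExchangeCompatible D rowOf qs j₀ → ∀ v : Fin nq → Bool, RowExchangeAt D rowOf qs us j₀ v)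
    (h₂ : ∃ x : ℝ, 0 < x ∧ ∀ u ∈ Icc (Real.pi / 3) (Real.pi / 2), ArmRateAt x u)
    (h₃ : (∀ (m k nq : ℕ) (D : SlabData m k) (rowOf : Fin k → Fin m) (qs : Fin nq → Query m k)
        (us : ℕ → ℝ) (j₀ : ℕ), D.Admissible → (∀ j, us j ∈ Icc (Real.pi / 3) (2 * Real.pi / 3)) →
        ExchangeCompatible D rowOf qs j₀ → ∀ v : Fin nq → Bool, RowExchangeAt D rowOf qs us j₀ v) →
      (∃ x : ℝ, 0 < x ∧ ∀ u ∈ Icc (Real.pi / 3) (Real.pi / 2), ArmRateAt x u) →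
      ∀ u ∈ Icc (Real.pi / 3) (Real.pi / 2), CylinderShearAt u)
    (h₄ : ∃ c : ℝ, 0 < c ∧ ∀ S : Set ℤ, (S = ∅ ∨ S = Set.univ) → ∀ n : ℕ, 1 ≤ n →
      ∀ (a b : ℤ) (E : Set Obs), MeasurableSet E → CondRSWBound c S n a b E)
    (h₅ : CylinderShearAt (Real.pi / 3) →
      (∃ c : ℝ, 0 < c ∧ ∀ S : Set ℤ, (S = ∅ ∨ S = Set.univ) → ∀ n : ℕ, 1 ≤ n →
        ∀ (a b : ℤ) (E : Set Obs), MeasurableSet E → CondRSWBound c S n a b E) →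
      (∃ K₀ : ℂ ≃L[ℝ] ℂ, IsTriShear K₀ ∧ CrudeCardyAlong K₀ ∅) →
      ∃ K₀ : ℂ ≃L[ℝ] ℂ, IsTriShear K₀ ∧ RectTransport K₀.symm)
    (h₆ : (∃ K₀ : ℂ ≃L[ℝ] ℂ, IsTriShear K₀ ∧ RectTransport K₀.symm) →
      (∃ c : ℝ, 0 < c ∧ ∀ S : Set ℤ, (S = ∅ ∨ S = Set.univ) → ∀ n : ℕ, 1 ≤ n →
        ∀ (a b : ℤ) (E : Set Obs), MeasurableSet E → CondRSWBound c S n a b E) →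
      (∃ K₀ : ℂ ≃L[ℝ] ℂ, IsTriShear K₀ ∧ CrudeCardyAlong K₀ ∅) →
      ∀ R : ConformalRectangle, R.HasCrossingLimit (mixedCrossingProb Set.univ R)
        Literature.Probability.RandomPlanarGeometry.cardyFunction)
    (h₇ : ∃ K₀ : ℂ ≃L[ℝ] ℂ, IsTriShear K₀ ∧ CrudeCardyAlong K₀ ∅) : CruxStatement := by
  show Summit.CriticalPhenomena.CardyFormulaZ2.Theses.CardyIKTransport.IKLinearTransport
  have hshear : CylinderShearAt (Real.pi / 3) := h₃ h₁ h₂ _ pi_div_three_mem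
  have hcardy := h₆ (h₅ hshear h₄ h₇) h₄ h₇
  rw [crux_iff]
  exact ⟨ContinuousLinearEquiv.refl ℝ ℂ, cardyOnImages_refl_of_isoCardy hcardy⟩

/-! ## Registered stubs (the only `sorry`s of the line) -/

/-- STUB 1 · exact row exchange on finite cylinders (size M–L: the diagram-level commutation in the
annular dilute Temperley–Lieb algebra at `n = 1` for ALL `N` and all pairs on the curve — train
argument from the face Yang–Baxter equation + inversion relation — then summation over everything
off the block; Mathlib only: Finset sums over `… → Bool`, `SimpleGraph.Reachable`). -/
theorem stub_RowExchange :
    ∀ (m k nq : ℕ) (D : SlabData m k) (rowOf : Fin k → Fin m) (qs : Fin nq → Query m k)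
      (us : ℕ → ℝ) (j₀ : ℕ), D.Admissible → (∀ j, us j ∈ Icc (Real.pi / 3) (2 * Real.pi / 3)) →
      ExchangeCompatible D rowOf qs j₀ → ∀ v : Fin nq → Bool, RowExchangeAt D rowOf qs us j₀ v := by
  sorry

/-- STUB 2 · one-arm anisotropy on the cylinder — first milestone and cheapest falsifier (size L–XL:
existence of the rate for each `N` by Perron–Frobenius in the arm sector; the `1/N` term of one
eigenvalue ratio by a two-sector rigorous `T–Q` / NLIE analysis at the `sℓ(3)` point). -/
theorem stub_CylinderArmAnisotropy :
    ∃ x : ℝ, 0 < x ∧ ∀ u ∈ Icc (Real.pi / 3) (Real.pi / 2), ArmRateAt x u := by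
  sorry

/-- STUB 3 · THE SPECTRAL SHEAR (size XL, hardest; the lead's stub): common eigenvectors from row
exchange, the spectral law for every level below any fixed `X` (momentum included, Jordan cells
handled on joint generalised eigenspaces), tightness of the spectral sums at macroscopic separations;
the common velocity is calibrated to `sin u` by the one-arm rate. -/
theorem stub_SpectralShearCylinder :
    (∀ (m k nq : ℕ) (D : SlabData m k) (rowOf : Fin k → Fin m) (qs : Fin nq → Query m k)
        (us : ℕ → ℝ) (j₀ : ℕ), D.Admissible → (∀ j, us j ∈ Icc (Real.pi / 3) (2 * Real.pi / 3)) →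
        ExchangeCompatible D rowOf qs j₀ → ∀ v : Fin nq → Bool, RowExchangeAt D rowOf qs us j₀ v) →
      (∃ x : ℝ, 0 < x ∧ ∀ u ∈ Icc (Real.pi / 3) (Real.pi / 2), ArmRateAt x u) →
      ∀ u ∈ Icc (Real.pi / 3) (Real.pi / 2), CylinderShearAt u := by
  sorry

/-- STUB 4 · conditional RSW for the two homogeneous members of the gauge (size L for `S = univ`, no
FKG — the crux's recorded obstruction in its lightest form; the `S = ∅` case is classical site-`𝕋`
RSW with FKG). Weaker than line pinned-diagram-exchange's `stub_ConditionalRSW` (all `S`): a proof of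
that stub closes this one; implies stmt-5911 at `S = univ`. -/
theorem stub_IsoApriori :
    ∃ c : ℝ, 0 < c ∧ ∀ S : Set ℤ, (S = ∅ ∨ S = Set.univ) → ∀ n : ℕ, 1 ≤ n →
      ∀ (a b : ℤ) (E : Set Obs), MeasurableSet E → CondRSWBound c S n a b E := by
  sorry

/-- STUB 5 · from the cylinder shear at `u = π/3` to rectangle transport through `K₀⁻¹` (size L).
Sketch: (1) plane ↔ cylinder: on a window of `w < N(1-κ)` columns the planar gauge's law (the free
corner field, Disproof §4.2) and the cylinder's (each face row's plaquette parities conditioned to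
even sum) are within total variation `C N (7-4√3)^{N-w}` (zero at `π/3`); (2) DETERMINISTIC
sandwich by pattern events on `ε`-spaced distinguished rows `r_0 = ` bottom side, …, `r_m = ` top
side: `cross(R) ⊆ V(A_0, A_m)` (window arcs on the rim rows joined in the slab), and
`V(A_0^ρ, A_m^ρ) ∖ ⋃_i V(A_0^ρ, F_i) ⊆ cross(R^{+ρ}) ∪ Gᶜ` with DETECTOR arcs `F_i` on row `r_i` just
outside the enlarged window and `G` = "no monochromatic path of horizontal extent `≥ L` inside one
thin slab" — `P(Gᶜ) ≤ (H/ε)(C/L)(1-c)^{L/2ε}` for BOTH members by chaining `CondRSWBound` over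
`ε`-separated boxes (margin = box size, no FKG needed) and colour symmetry; (3) the same
combinatorics for the `S = ∅` member on the parallelogram `K₀⁻¹ R` (horizontal sides, slid row
windows — exactly `d.shear (π/3)`), whose crude crossing probabilities converge to Cardy values
continuous in `ρ` (`CrudeCardyAlong K₀ ∅`); (4) transfer every pattern probability by
`CylinderShearAt (π/3)` and let `ε, L, ρ → 0`; joint families and the other crossing directions
alike. -/
theorem stub_SlabToRectangles :
    CylinderShearAt (Real.pi / 3) →
      (∃ c : ℝ, 0 < c ∧ ∀ S : Set ℤ, (S = ∅ ∨ S = Set.univ) → ∀ n : ℕ, 1 ≤ n →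
        ∀ (a b : ℤ) (E : Set Obs), MeasurableSet E → CondRSWBound c S n a b E) →
      (∃ K₀ : ℂ ≃L[ℝ] ℂ, IsTriShear K₀ ∧ CrudeCardyAlong K₀ ∅) →
      ∃ K₀ : ℂ ≃L[ℝ] ℂ, IsTriShear K₀ ∧ RectTransport K₀.symm := by
  sorry

/-- STUB 6 · RECTANGLES DETERMINE (size L): joint rectangle-crossing statistics (+ RSW-type a-priori
bounds, + crude Cardy for the `S = ∅` member along `K₀`) give Cardy's formula for `IK(π/2)` in EVERY
conformal rectangle in its own square embedding, `K = 1`. Sketch: in the Schramm–Smirnov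
quad-crossing space (tree: `QuadCrossingSpace`, `isSubseqQuadLimit_iff`, `rectQuad`/`perturbQuad`
monotonicity) both families are precompact; rectangle events are continuity sets of every
subsequential limit of `IK(π/2)` because `P(Q crossed, Q^ρ not)` is itself a joint rectangle
probability, transferred to site-`𝕋` by `RectTransport`; circuits in annuli and crossing events of
general quads lie in the σ-field generated by rectangle crossings modulo null sets of RSW-type
limits (GPS-type reconstruction), so every subsequential limit of `IK(π/2)` IS the (`K₀`-drawn
site-`𝕋` =) percolation limit; crude crossing probabilities of a Jordan `R` converge along the
subsequence to that limit's value by deterministic inner/outer quad sandwiches of the crude event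
+ continuity of the PERCOLATION limit in the quad (the only place wild Jordan arcs enter; same
bookkeeping as pinned-diagram-exchange's `stub_CouplingToLimits`), and `CrudeCardyAlong K₀ ∅`
identifies the value as `F(η(R))`; all subsequences agreeing, the full limit exists. -/
theorem stub_RectanglesDetermine :
    (∃ K₀ : ℂ ≃L[ℝ] ℂ, IsTriShear K₀ ∧ RectTransport K₀.symm) →
      (∃ c : ℝ, 0 < c ∧ ∀ S : Set ℤ, (S = ∅ ∨ S = Set.univ) → ∀ n : ℕ, 1 ≤ n →
        ∀ (a b : ℤ) (E : Set Obs), MeasurableSet E → CondRSWBound c S n a b E) →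
      (∃ K₀ : ℂ ≃L[ℝ] ℂ, IsTriShear K₀ ∧ CrudeCardyAlong K₀ ∅) →
      ∀ R : ConformalRectangle, R.HasCrossingLimit (mixedCrossingProb Set.univ R)
        Literature.Probability.RandomPlanarGeometry.cardyFunction := by
  sorry

/-- STUB 7 · crude Cardy for the `S = ∅` member along the explicit shear `K₀ = moduliShear ζ`
(Smirnov's theorem, PROVED in the tree as `hasCrossingLimit_triDomainCrossingProb_holds`, + crude-vs-
canonical discretisation glue on `𝕋`; size M–L). SHARED VERBATIM with line pinned-diagram-exchange
(`stub_CrudeCardyTri`, identical signature): one proof serves both lines. -/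
theorem stub_CrudeCardyTri : ∃ K₀ : ℂ ≃L[ℝ] ℂ, IsTriShear K₀ ∧ CrudeCardyAlong K₀ ∅ := by
  sorry

/-- THE SKELETON THEOREM (D-0027 §3.3): concludes the crux `IKLinearTransport` BY NAME, modulo exactly
the seven registered stubs `stub_*` (the only `sorry`s of this file). -/
theorem IKLinearTransport_of :
    Summit.CriticalPhenomena.CardyFormulaZ2.Theses.CardyIKTransport.IKLinearTransport :=
  IKLinearTransport_of_stubs stub_RowExchange stub_CylinderArmAnisotropy stub_SpectralShearCylinder
    stub_IsoApriori stub_SlabToRectangles stub_RectanglesDetermine stub_CrudeCardyTri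

end Summit.CriticalPhenomena.CardyFormulaZ2.Cruxes.IKLinearTransport.SpectralShear

end
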